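import Summits.PneNP.PneNP.Theorems.ExpanderLinearGeneratorsColumnTwoPipeline
import Summits.PneNP.PneNP.Theorems.ExpanderLinearGeneratorsColumnTwoSigma
import Summits.PneNP.PneNP.Theorems.ExpanderLinearGeneratorsGridRoutingCruxFamily
import Mathlib.Analysis.Complex.ExponentialBounds

/-!
# PneNP / ExpanderLinearGenerators — `LinearGeneratorDepthFregeHard` at column weight two:
parameters, eventual inequalities and the closing arithmetic

Route `PneNP/ExpanderLinearGenerators`, crux stmt-PneNP-11443
(`Summit.PneNP.PneNP.Theses.ExpanderLinearGenerators.LinearGeneratorDepthFregeHard`, Krajíček's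
Problem 19.4.5 in universal-expander form). The crux quantifies over ALL `ℓ`-sparse unsolvable
systems over `𝔽₂` whose row supports form an `(n^{1-δ}, 3ℓ/4)`-boundary expander. This file
proves its conclusion — every depth-`d` `textbookFrege` refutation has size `≥ 2^{n^ε}` — under
ONE extra hypothesis: every variable occurs in at most two equations (the Tseitin / graph case).
In print this slice follows from Galesi–Itsykson–Riazanov–Sofronova's treewidth theorem (in the
tree only as the named fact `galesiEtAl_tseitin_treewidth_depthFrege_lowerBound`, used
conditionally in `…LinearGeneratorDepthFregeHardTseitin`); here it is proved outright, by ROUTING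
instead of switching lemmas:

1. an unsolvable system of column weight `≤ 2` has an odd closed component, and local boundary
   expansion makes every closed component large, locally sparse and locally vertex-expanding;
2. Krivelevich's extraction gives a dense core, and the Krivelevich–Sudakov iteration a clique
   minor of polynomial order `n^{Ω(1-δ)}` in every odd closed component
   (`exists_minor_in_component`);
3. along the minor, the sum-encoding of the system projects, by one substitution of constant-size
   parity gadgets, onto the grid routing Tseitin system of the bijective pigeonhole principle
   (`exists_routing_subst` + `TextbookFrege.transfer_isDepthProofOf`), whose bounded-depth Frege
   refutations are exponentially long (`GridRouting.gridTseitin_depthFrege_lowerBound`, from the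
   tree's `k`-evaluation lower bound for the onto pigeonhole principle).

This file holds the parameter lemmas (`four_pow_mul_lt`, `linking_radius`, `vol_le`), the closing
arithmetic (`lb_arith`, `transferLines_mono`, `transferBound_le'`, `sum_gridSystem_snd`) and the
eventual inequalities (`natLog_le`, `eventually_volume`, `eventually_params`); the slice itself is
`…ColumnTwoFinal`.

References: J. Krajíček, *Proof complexity* (CUP 2019), Problem 19.4.5; A. Urquhart, X. Fu,
*Simplified lower bounds for propositional proofs*, NDJFL 37 (1996); E. Ben-Sasson, *Hard examples
for the bounded depth Frege proof system*, Comput. Complexity 11 (2002); M. Krivelevich, SIAM J.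
Discrete Math. 32 (2018); M. Krivelevich, B. Sudakov, GAFA 19 (2009); N. Galesi, D. Itsykson,
A. Riazanov, A. Sofronova, APAL 174 (2023) (the treewidth form, for comparison).
-/

namespace Summit.PneNP.PneNP.Theorems.ColumnTwo

open Filter Finset Literature.Computability.MetaComplexity
open Literature.Computability.MetaComplexity.TextbookFrege
open Literature.Computability.Complexity (PropForm Clause CNF Literal)
open Literature.Computability.MetaComplexity.KrajicekRamsey (clauseOf)
open Summit.PneNP.PneNP.Theorems.GridRouting

/-! ### Parameters -/

/-- The radius of fat balls: `4^t r < 3 · 5^t` for `t = 4(log₂ r + 1)`. [folklore] -/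
theorem four_pow_mul_lt (r : ℕ) : 4 ^ (4 * (Nat.log 2 r + 1)) * r < 3 * 5 ^ (4 * (Nat.log 2 r + 1)) := by
  set j := Nat.log 2 r + 1 with hj
  have h1 : r < 2 ^ j := Nat.lt_pow_succ_log_self (by norm_num) r
  have h2 : 4 ^ (4 * j) * 2 ^ j ≤ 5 ^ (4 * j) := by
    rw [pow_mul, pow_mul, ← mul_pow]
    exact Nat.pow_le_pow_left (by norm_num) j
  have h3 : 0 < 4 ^ (4 * j) := by positivity
  nlinarith

/-- Bernoulli in `ℕ`: `b^{j+1} + (j+1) b^j ≤ (b+1)^{j+1}`. [folklore] -/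
theorem pow_add_mul_pow_le (b : ℕ) : ∀ j : ℕ, b ^ (j + 1) + (j + 1) * b ^ j ≤ (b + 1) ^ (j + 1)
  | 0 => by simp
  | j + 1 => by
    have ih := pow_add_mul_pow_le b j
    have h1 : (b + 1) ^ (j + 2) = (b + 1) * (b + 1) ^ (j + 1) := by ring
    have h2 : (b + 1) * (b ^ (j + 1) + (j + 1) * b ^ j) ≤ (b + 1) * (b + 1) ^ (j + 1) :=
      Nat.mul_le_mul_left _ ih
    have h3 : b ^ (j + 2) + (j + 2) * b ^ (j + 1) ≤ (b + 1) * (b ^ (j + 1) + (j + 1) * b ^ j) := by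
      have : b ^ (j + 2) = b * b ^ (j + 1) := by ring
      have : b ^ (j + 1) = b * b ^ j := by ring
      nlinarith [Nat.zero_le (b ^ j), Nat.zero_le j]
    rw [h1]; exact h3.trans h2

/-- The radius of linking: `(2K)^s m < (2K+1)^s` for `s = 2K Λ`, `m < 2^Λ`, `K ≥ 1`. [folklore] -/
theorem linking_radius {K Λ m : ℕ} (hK : 1 ≤ K) (hm : m < 2 ^ Λ) :
    (2 * K) ^ (2 * K * Λ) * m < (2 * K + 1) ^ (2 * K * Λ) := by
  have hbase : 2 * (2 * K) ^ (2 * K) ≤ (2 * K + 1) ^ (2 * K) := by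
    obtain ⟨j, hj⟩ : ∃ j, 2 * K = j + 1 := ⟨2 * K - 1, by omega⟩
    have h := pow_add_mul_pow_le (2 * K) j
    rw [← hj] at h
    have e : (2 * K) ^ (2 * K) = 2 * K * (2 * K) ^ j := by
      rw [hj]; ring
    omega
  have h1 : (2 * K) ^ (2 * K * Λ) * 2 ^ Λ ≤ (2 * K + 1) ^ (2 * K * Λ) := by
    rw [pow_mul (2 * K) (2 * K) Λ, pow_mul (2 * K + 1) (2 * K) Λ, ← mul_pow]
    refine Nat.pow_le_pow_left ?_ Λ
    omega
  have h2 : 0 < (2 * K) ^ (2 * K * Λ) := by positivity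
  nlinarith

/-! ### The lower-bound arithmetic -/

/-- The closing arithmetic: a grid refutation of size `S' ≤ T (144 S + 224 M + 3)³` with
`S' ≥ 2^{k^ε₀}` forces `S ≥ 2^{n^ε}` once `227 n ≤ 144 · 2^{n^ε}`, `T · 288³ < 2^{n^ε}` and
`4 n^ε < k^{ε₀}`. [folklore] -/
theorem lb_arith {ε₀ ε : ℝ} {k n M S S' T : ℕ} (hT : 0 < T)
    (hlb : (2 : ℝ) ^ ((k : ℝ) ^ ε₀) ≤ S') (hsz : S' ≤ T * (144 * S + 224 * M + 3) ^ 3)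
    (hMn : M ≤ n) (hn : 1 ≤ n) (h227 : 227 * (n : ℝ) ≤ 144 * (2 : ℝ) ^ ((n : ℝ) ^ ε))
    (hT3 : (T : ℝ) * 288 ^ 3 < (2 : ℝ) ^ ((n : ℝ) ^ ε)) (hk : 4 * (n : ℝ) ^ ε < (k : ℝ) ^ ε₀) :
    (2 : ℝ) ^ ((n : ℝ) ^ ε) ≤ S := by
  by_contra hlt
  push Not at hlt
  set X : ℝ := (2 : ℝ) ^ ((n : ℝ) ^ ε) with hX
  have hX0 : 0 < X := by positivity
  have hMn' : (M : ℝ) ≤ n := by exact_mod_cast hMn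
  have hn' : (1 : ℝ) ≤ n := by exact_mod_cast hn
  have h1 : ((144 * S + 224 * M + 3 : ℕ) : ℝ) < 288 * X := by push_cast; nlinarith
  have h2 : (S' : ℝ) < X ^ 4 :=
    calc (S' : ℝ) ≤ T * ((144 * S + 224 * M + 3 : ℕ) : ℝ) ^ 3 := by exact_mod_cast hsz
      _ < T * (288 * X) ^ 3 := by
          have hT' : (0 : ℝ) < T := by exact_mod_cast hT
          exact mul_lt_mul_of_pos_left (pow_lt_pow_left₀ h1 (by positivity) (by norm_num)) hT'
      _ = (T * 288 ^ 3) * X ^ 3 := by ring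
      _ ≤ X * X ^ 3 := mul_le_mul_of_nonneg_right hT3.le (by positivity)
      _ = X ^ 4 := by ring
  have h3 : (2 : ℝ) ^ ((k : ℝ) ^ ε₀) < (2 : ℝ) ^ (4 * (n : ℝ) ^ ε) := by
    calc (2 : ℝ) ^ ((k : ℝ) ^ ε₀) ≤ (S' : ℝ) := hlb
      _ < X ^ 4 := h2
      _ = (2 : ℝ) ^ (4 * (n : ℝ) ^ ε) := by
          rw [hX, ← Real.rpow_natCast, ← Real.rpow_mul (by norm_num), mul_comm]
          norm_num
  have h4 : (k : ℝ) ^ ε₀ < 4 * (n : ℝ) ^ ε := (Real.rpow_lt_rpow_left_iff one_lt_two).1 h3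
  linarith

/-- Monotonicity of the transfer line count in both size parameters. [folklore] -/
theorem transferLines_mono {ℓ₀ ℓ₀' Z Z' qq k : ℕ} (h1 : ℓ₀ ≤ ℓ₀') (h2 : Z ≤ Z') :
    transferLines ℓ₀ Z qq k ≤ transferLines ℓ₀' Z' qq k := by
  unfold transferLines transferClauseLines tautLines
  gcongr

/-- The grid charges have odd sum. [folklore] -/
theorem sum_gridSystem_snd (k : ℕ) : ∑ i, (gridSystem k i).2 = 1 := by
  have : ∑ i, (gridSystem k i).2 = ∑ r : RowIdx k, charge k r := by
    rw [← (rowEquiv k).sum_comp]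
    simp [gridSystem]
  rw [this, sum_charge]

/-- **The volume bound**: with `K = 1000Λ(Λ+1)`, `s = 2KΛ`, `t = 4(log₂ r + 1) ≤ 4Λ`,
`L = 2(s+1)+2(t+1)`, `p = 6 · nRows kg`, `q = 8pL`, the deleted volume is
`(12K+3)(pq + p²L) + 3 ≤ 10^{11} Λ⁵ (kg+3)⁴`. [folklore] -/
theorem vol_le {Λ r kg Kx s t L p q : ℕ} (hΛ : 1 ≤ Λ) (hlog : Nat.log 2 r + 1 ≤ Λ)
    (hKx : Kx = 1000 * Λ * (Λ + 1)) (hs : s = 2 * Kx * Λ) (ht : t = 4 * (Nat.log 2 r + 1))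
    (hL : L = 2 * (s + 1) + 2 * (t + 1)) (hp : p = 6 * nRows kg) (hq : q = 8 * p * L) :
    (12 * Kx + 3) * (p * q + p * p * L) + 3 ≤ 10 ^ 11 * Λ ^ 5 * (kg + 3) ^ 4 := by
  have hK : Kx ≤ 2000 * Λ ^ 2 := by rw [hKx]; nlinarith
  have h12 : 12 * Kx + 3 ≤ 24003 * Λ ^ 2 := by nlinarith
  have hpB : p ≤ 6 * (kg + 3) ^ 2 := by rw [hp]; exact Nat.mul_le_mul_left 6 (nRows_bounds kg).1
  have htΛ : t ≤ 4 * Λ := by rw [ht]; omega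
  have hsΛ : s ≤ 4000 * Λ ^ 3 := by
    rw [hs]
    calc 2 * Kx * Λ ≤ 2 * (2000 * Λ ^ 2) * Λ := by gcongr
      _ = 4000 * Λ ^ 3 := by ring
  have hLΛ : L ≤ 8012 * Λ ^ 3 := by
    rw [hL]
    have : Λ ≤ Λ ^ 3 := by
      calc Λ = Λ * 1 * 1 := by ring
        _ ≤ Λ * Λ * Λ := Nat.mul_le_mul (Nat.mul_le_mul_left _ hΛ) hΛ
        _ = Λ ^ 3 := by ring
    have : 1 ≤ Λ ^ 3 := Nat.one_le_pow _ _ hΛ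
    omega
  have hpq : p * q + p * p * L = 9 * (p * p * L) := by rw [hq]; ring
  rw [hpq]
  have hmain : (12 * Kx + 3) * (9 * (p * p * L)) ≤ 62309099664 * Λ ^ 5 * (kg + 3) ^ 4 :=
    calc (12 * Kx + 3) * (9 * (p * p * L))
        ≤ (24003 * Λ ^ 2) * (9 * ((6 * (kg + 3) ^ 2) * (6 * (kg + 3) ^ 2) * (8012 * Λ ^ 3))) := by
          gcongr
      _ = 62309099664 * Λ ^ 5 * (kg + 3) ^ 4 := by ring
  have hone : 1 ≤ Λ ^ 5 * (kg + 3) ^ 4 := Nat.one_le_iff_ne_zero.2 (by positivity)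
  nlinarith

/-- A clean form of the polynomial transfer bound (`16 + 3 = 19`). [folklore] -/
theorem transferBound_le' (S m : ℕ) :
    transferLines S (S + 224 * m) 16 4 * (40 * (19 * (S + 224 * m + 3) + 4) + 300) ≤
      transferConst * (S + 224 * m + 3) ^ 3 := by
  simpa using transferBound_le S m

/-! ### Eventual inequalities in the number of variables -/

/-- `Λ = log₂(2n) + 1 ≤ 4 log n` for `n ≥ 3`. [folklore] -/
theorem natLog_le {n : ℕ} (hn : 3 ≤ n) : ((Nat.log 2 (2 * n) + 1 : ℕ) : ℝ) ≤ 4 * Real.log n := by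
  set L := Nat.log 2 (2 * n) with hL
  have h1 : 2 ^ L ≤ 2 * n := Nat.pow_log_le_self 2 (by omega)
  have h2 : ((2 : ℕ) : ℝ) ^ L ≤ (2 * n : ℕ) := by exact_mod_cast h1
  have hn0 : (0 : ℝ) < n := by exact_mod_cast (show 0 < n by omega)
  have h3 : (L : ℝ) * Real.log 2 ≤ Real.log 2 + Real.log n := by
    have := Real.log_le_log (by positivity) h2
    rw [Real.log_pow] at this
    push_cast at this
    rwa [Real.log_mul (by norm_num) hn0.ne'] at this
  have h4 : (1 : ℝ) < Real.log n := by
    rw [Real.lt_log_iff_exp_lt hn0]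
    have := Real.exp_one_lt_d9
    have : (3 : ℝ) ≤ n := by exact_mod_cast hn
    linarith
  have h5 := Real.log_two_gt_d9
  have h6 := Real.log_two_lt_d9
  have hL0 : (0 : ℝ) ≤ L := Nat.cast_nonneg L
  push_cast
  nlinarith

/-- The polylog-times-power volume is eventually below `n^α`. [folklore] -/
theorem eventually_volume {α : ℝ} (hα : 0 < α) :
    ∀ᶠ n : ℕ in atTop, (10 : ℝ) ^ 11 * (4 * Real.log n) ^ 5 * (2 * (n : ℝ) ^ (α / 5)) ^ 4 + 1 ≤
      (n : ℝ) ^ α := by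
  have hα5 : 0 < α / 5 := by positivity
  set c : ℝ := 1 / (2 * 10 ^ 11 * 4 ^ 5 * 16) with hc
  have hcpos : 0 < c := by positivity
  have h1 : ∀ᶠ x : ℝ in atTop, ‖Real.log x ^ (5 : ℝ)‖ ≤ c * ‖x ^ (α / 5)‖ :=
    (isLittleO_log_rpow_rpow_atTop 5 hα5).def hcpos
  have h2 : ∀ᶠ x : ℝ in atTop, (2 : ℝ) ≤ x ^ α := (tendsto_rpow_atTop hα).eventually_ge_atTop 2
  have h3 := (h1.and (h2.and (eventually_ge_atTop (1 : ℝ)))).natCast_atTop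
  filter_upwards [h3] with n hn
  obtain ⟨hlog, hpow, hn1⟩ := hn
  have hn0 : (0 : ℝ) ≤ n := Nat.cast_nonneg n
  have hl0 : 0 ≤ Real.log n := Real.log_nonneg hn1
  have e5 : Real.log n ^ (5 : ℝ) = Real.log n ^ 5 := by
    rw [← Real.rpow_natCast]; norm_num
  rw [Real.norm_of_nonneg (by positivity), Real.norm_of_nonneg (by positivity), e5] at hlog
  have e1 : ((n : ℝ) ^ (α / 5)) ^ 4 * (n : ℝ) ^ (α / 5) = (n : ℝ) ^ α := by
    rw [← Real.rpow_natCast, ← Real.rpow_mul hn0, ← Real.rpow_add' hn0 (by positivity)]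
    norm_num; ring_nf
  have hp0 : 0 ≤ (n : ℝ) ^ (α / 5) := by positivity
  have key : (10 : ℝ) ^ 11 * (4 * Real.log n) ^ 5 * (2 * (n : ℝ) ^ (α / 5)) ^ 4 ≤ (n : ℝ) ^ α / 2 := by
    calc (10 : ℝ) ^ 11 * (4 * Real.log n) ^ 5 * (2 * (n : ℝ) ^ (α / 5)) ^ 4
        = (10 ^ 11 * 4 ^ 5 * 16) * Real.log n ^ 5 * ((n : ℝ) ^ (α / 5)) ^ 4 := by ring
      _ ≤ (10 ^ 11 * 4 ^ 5 * 16) * (c * (n : ℝ) ^ (α / 5)) * ((n : ℝ) ^ (α / 5)) ^ 4 := by gcongr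
      _ = (n : ℝ) ^ α / 2 := by rw [hc, ← e1]; ring
  linarith

/-- **The eventual inequalities.** [folklore] -/
theorem eventually_params {α ε₀ : ℝ} (hα : 0 < α) (hα1 : α ≤ 1) (hε₀ : 0 < ε₀) (K₁ T : ℕ) :
    ∀ᶠ n : ℕ in atTop, 3 ≤ n ∧
      10 ^ 11 * (Nat.log 2 (2 * n) + 1) ^ 5 * (⌊(n : ℝ) ^ (α / 5)⌋₊ + 3) ^ 4 ≤ ⌊(n : ℝ) ^ α⌋₊ ∧
      K₁ ≤ ⌊(n : ℝ) ^ (α / 5)⌋₊ ∧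
      227 * (n : ℝ) ≤ 144 * (2 : ℝ) ^ ((n : ℝ) ^ (α * ε₀ / 10)) ∧
      (T : ℝ) * 288 ^ 3 < (2 : ℝ) ^ ((n : ℝ) ^ (α * ε₀ / 10)) ∧
      4 * (n : ℝ) ^ (α * ε₀ / 10) < ((⌊(n : ℝ) ^ (α / 5)⌋₊ : ℕ) : ℝ) ^ ε₀ ∧
      ⌊(n : ℝ) ^ α⌋₊ ≤ n := by
  have hα5 : 0 < α / 5 := by positivity
  have hε : 0 < α * ε₀ / 10 := by positivity
  have e1 := eventually_volume hα
  have e2 : ∀ᶠ n : ℕ in atTop, (max K₁ 3 : ℝ) ≤ (n : ℝ) ^ (α / 5) :=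
    ((tendsto_rpow_atTop hα5).comp tendsto_natCast_atTop_atTop).eventually_ge_atTop _
  have e3 := eventually_linear_le_two_rpow (T * 288 ^ 3) hε
  have e4 : ∀ᶠ n : ℕ in atTop, 4 * (2 : ℝ) ^ ε₀ + 1 ≤ (n : ℝ) ^ (α * ε₀ / 10) :=
    ((tendsto_rpow_atTop hε).comp tendsto_natCast_atTop_atTop).eventually_ge_atTop _
  filter_upwards [e1, e2, e3, e4, eventually_ge_atTop 3] with n h1 h2 h3 h4 h5
  have hn0 : (0 : ℝ) ≤ n := Nat.cast_nonneg n
  have hn1 : (1 : ℝ) ≤ n := by exact_mod_cast (show 1 ≤ n by omega)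
  have hK3 : (3 : ℝ) ≤ (n : ℝ) ^ (α / 5) := le_trans (by exact_mod_cast le_max_right K₁ 3) h2
  have hfl : (n : ℝ) ^ (α / 5) - 1 < ⌊(n : ℝ) ^ (α / 5)⌋₊ := by
    have := Nat.lt_floor_add_one ((n : ℝ) ^ (α / 5)); linarith
  refine ⟨h5, ?_, ?_, ?_, ?_, ?_, ?_⟩
  · rw [Nat.le_floor_iff (by positivity)]
    have hΛ := natLog_le h5
    have hk : ((⌊(n : ℝ) ^ (α / 5)⌋₊ : ℕ) : ℝ) + 3 ≤ 2 * (n : ℝ) ^ (α / 5) := by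
      have := Nat.floor_le (show (0 : ℝ) ≤ (n : ℝ) ^ (α / 5) by positivity)
      linarith
    have hΛ0 : (0 : ℝ) ≤ ((Nat.log 2 (2 * n) + 1 : ℕ) : ℝ) := Nat.cast_nonneg _
    have ecast : ((10 ^ 11 * (Nat.log 2 (2 * n) + 1) ^ 5 * (⌊(n : ℝ) ^ (α / 5)⌋₊ + 3) ^ 4 : ℕ) : ℝ) =
        (10 : ℝ) ^ 11 * ((Nat.log 2 (2 * n) + 1 : ℕ) : ℝ) ^ 5 *
          (((⌊(n : ℝ) ^ (α / 5)⌋₊ : ℕ) : ℝ) + 3) ^ 4 := by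
      push_cast; ring
    rw [ecast]
    calc (10 : ℝ) ^ 11 * ((Nat.log 2 (2 * n) + 1 : ℕ) : ℝ) ^ 5 * (((⌊(n : ℝ) ^ (α / 5)⌋₊ : ℕ) : ℝ) + 3) ^ 4
        ≤ (10 : ℝ) ^ 11 * (4 * Real.log n) ^ 5 * (2 * (n : ℝ) ^ (α / 5)) ^ 4 := by
          gcongr
      _ ≤ (n : ℝ) ^ α := by linarith
  · rw [Nat.le_floor_iff (by positivity)]
    exact le_trans (by exact_mod_cast le_max_left K₁ 3) h2
  · have : (0 : ℝ) ≤ (2 : ℝ) ^ ((n : ℝ) ^ (α * ε₀ / 10)) := by positivity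
    linarith [h3.1]
  · have h3' := h3.2
    push_cast at h3'
    have hT1 : (0 : ℝ) < 288 ^ 3 := by norm_num
    have : (T : ℝ) * 288 ^ 3 < 8 * (T * 288 ^ 3) + 1 := by nlinarith [Nat.cast_nonneg (α := ℝ) T]
    nlinarith [Nat.cast_nonneg (α := ℝ) T]
  · -- `4 n^ε < ⌊n^{α/5}⌋^{ε₀}`, since `⌊n^{α/5}⌋ ≥ n^{α/5}/2` and `n^{αε₀/10} ≥ 4·2^{ε₀} + 1`
    have hhalf : (n : ℝ) ^ (α / 5) / 2 ≤ ⌊(n : ℝ) ^ (α / 5)⌋₊ := by linarith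
    have hpos : (0 : ℝ) < (n : ℝ) ^ (α / 5) / 2 := by linarith
    have hmono : ((n : ℝ) ^ (α / 5) / 2) ^ ε₀ ≤ ((⌊(n : ℝ) ^ (α / 5)⌋₊ : ℕ) : ℝ) ^ ε₀ :=
      Real.rpow_le_rpow hpos.le hhalf hε₀.le
    refine lt_of_lt_of_le ?_ hmono
    rw [Real.div_rpow (by positivity) (by norm_num), ← Real.rpow_mul hn0]
    have e : α / 5 * ε₀ = α * ε₀ / 10 + α * ε₀ / 10 := by ring
    rw [e, Real.rpow_add (by exact_mod_cast (show 0 < n by omega)), lt_div_iff₀ (by positivity)]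
    have hx : (0 : ℝ) ≤ (n : ℝ) ^ (α * ε₀ / 10) := by positivity
    have h2e : (0 : ℝ) ≤ (2 : ℝ) ^ ε₀ := by positivity
    nlinarith [mul_nonneg hx (sub_nonneg.2 h4), h4]
  · have hle : (n : ℝ) ^ α ≤ (n : ℕ) :=
      calc (n : ℝ) ^ α ≤ (n : ℝ) ^ (1 : ℝ) := Real.rpow_le_rpow_of_exponent_le hn1 hα1
        _ = n := Real.rpow_one _
    exact (Nat.floor_mono hle).trans (Nat.floor_natCast n).le

end Summit.PneNP.PneNP.Theorems.ColumnTwo
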